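import Summits.RiemannHypothesis.RiemannHypothesis.Theorems.WeilColumnYoungMoll
import HarnessLib

/-!
# The autocorrelation of the mollified function converges pointwise: `k_{g⋆φ_k}(t) → k_g(t)` (RH-FREE; FIN's atom-term limit)

Cell `rh-explicit`, WEIL column, seat handoff-prove-2 gen12.  For `g : ℝ → ℂ` continuous with compact support and every `t`:

  **`tendsto_weilConv_weilReflect_moll : Tendsto (fun k ↦ weilConv (g⋆φ_k) (weilReflect (g⋆φ_k)) t) atTop (𝓝 (weilConv g (weilReflect g) t))`**

(dominated convergence: pointwise `g⋆φ_k → g` from `tendsto_weilConv_moll`, the uniform bound `‖g⋆φ_k‖ ≤ sup‖g‖`, and the common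
support `[−R−1, R+1]`).  With D4 (`ThetaParams.norm_atom_le`) this gives the limit of the extra term of
`weilQuadratic_eq_handoff_of_consecutive` for `φ_k = P.phi k = P.gOdd ⋆ φ_k`.  Nothing here bears on the truth of RH.
-/

noncomputable section

set_option linter.dupNamespace false

open Complex Set MeasureTheory Filter Function
open scoped Real Topology ComplexConjugate

namespace Summit.RiemannHypothesis.RiemannHypothesis.Theorems.WeilColumn.ThetaMellin

open Literature.NumberTheory.LFunctions Literature.NumberTheory.LFunctions.WeilContinuous

variable {g : ℝ → ℂ}

/-- Uniform bound: `‖(g ⋆ φ_k)(x)‖ ≤ S` whenever `‖g‖ ≤ S` everywhere (`∫‖φ_k‖ = 1`). -/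
theorem norm_weilConv_moll_le {S : ℝ} (hS : ∀ u, ‖g u‖ ≤ S) (k : ℕ) (x : ℝ) : ‖weilConv g (moll k) x‖ ≤ S := by
  rw [weilConv_apply]
  have hS0 : 0 ≤ S := (norm_nonneg _).trans (hS 0)
  have hint : Integrable fun u ↦ S * ‖moll k (x - u)‖ := ((integrable_norm_moll k).comp_sub_left x).const_mul S
  refine (norm_integral_le_of_norm_le hint (Eventually.of_forall fun u ↦ ?_)).trans (le_of_eq ?_)
  · rw [norm_mul]; exact mul_le_mul_of_nonneg_right (hS u) (norm_nonneg _)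
  · rw [integral_const_mul, integral_norm_moll_sub, mul_one]

/-- A compactly supported function vanishes outside some `[−R, R]`. -/
theorem exists_radius_of_hasCompactSupport (hgs : HasCompactSupport g) : ∃ R : ℝ, 0 ≤ R ∧ ∀ u, R < |u| → g u = 0 := by
  obtain ⟨R, hR⟩ := hgs.isCompact.isBounded.subset_closedBall 0
  refine ⟨max R 0, le_max_right _ _, fun u hu ↦ ?_⟩
  by_contra h
  have := hR (subset_tsupport _ (Function.mem_support.2 h))
  rw [Metric.mem_closedBall, dist_zero_right, Real.norm_eq_abs] at this
  linarith [le_max_left R 0]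

/-- **`k_{g⋆φ_k}(t) → k_g(t)`** pointwise, for `g` continuous of compact support. [folklore: dominated convergence] -/
theorem tendsto_weilConv_weilReflect_moll (hgc : Continuous g) (hgs : HasCompactSupport g) (t : ℝ) :
    Tendsto (fun k ↦ weilConv (weilConv g (moll k)) (weilReflect (weilConv g (moll k))) t) atTop
      (𝓝 (weilConv g (weilReflect g) t)) := by
  obtain ⟨S, hS⟩ := hgc.bounded_above_of_compact_support hgs
  obtain ⟨R, hR0, hR⟩ := exists_radius_of_hasCompactSupport hgs
  have hS0 : 0 ≤ S := (norm_nonneg _).trans (hS 0)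
  have e : ∀ k, weilConv (weilConv g (moll k)) (weilReflect (weilConv g (moll k))) t =
      ∫ u, weilConv g (moll k) u * weilReflect (weilConv g (moll k)) (t - u) := fun k ↦ by rw [weilConv_apply]
  simp_rw [e]
  rw [weilConv_apply g]
  refine tendsto_integral_of_dominated_convergence (fun u ↦ (Icc (-(R + 1)) (R + 1)).indicator (fun _ ↦ S * S) u)
    (fun k ↦ ?_) ?_ (fun k ↦ Eventually.of_forall fun u ↦ ?_) (Eventually.of_forall fun u ↦ ?_)
  · -- measurability: the integrand is continuous
    have hc : Continuous (weilConv g (moll k)) := (isWeilTest_weilConv_moll hgc hgs k).1.continuous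
    exact (hc.mul ((Complex.continuous_conj.comp (hc.comp (continuous_const.sub continuous_id).neg)))).aestronglyMeasurable
  · exact (integrable_indicator_iff measurableSet_Icc).2 continuous_const.integrableOn_Icc
  · -- domination
    by_cases hu : u ∈ Icc (-(R + 1)) (R + 1)
    · rw [indicator_of_mem hu, norm_mul]
      refine mul_le_mul (norm_weilConv_moll_le hS k u) ?_ (norm_nonneg _) hS0
      simp only [weilReflect, Complex.norm_conj]
      exact norm_weilConv_moll_le hS k _
    · rw [indicator_of_notMem hu]
      have hu' : R + 1 < |u| := by
        rw [mem_Icc, not_and_or, not_le, not_le] at hu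
        rcases hu with hu | hu
        · rw [abs_of_neg (by linarith)]; linarith
        · rw [abs_of_pos (by linarith)]; linarith
      rw [weilConv_moll_eq_zero hR hu' k, zero_mul, norm_zero]
  · -- pointwise limit
    refine (tendsto_weilConv_moll hgc u).mul ?_
    simp only [weilReflect]
    exact (Complex.continuous_conj.tendsto _).comp (tendsto_weilConv_moll hgc (-(t - u)))

end Summit.RiemannHypothesis.RiemannHypothesis.Theorems.WeilColumn.ThetaMellin

end
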